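import Summits.AtomisticToContinuum.Crystallization.Theorems.OverbindingBudgetLocalRelaxation

/-!
# OverbindingBudget — the local relaxation test, III: truncated gains and the superposition theorem (lens-4 g28)

The transfer-friendly form of the cut.  A **truncated gain** `truncGain F G W = U(F) + I(F, W ∖ F) − U(G) − I(G, W ∖ F)` only sees the
window atoms `W = Y ∩ B̄(p, r)` (finite sums, no tails), so it moves under `ε`-matchings term by term (part IV).
`DenseImprovementT Y`: ONE gain `g`, ONE patch radius `R`, and for EVERY truncation scale `ρ ≥ ρ₀` a uniform density `Gd(ρ)` of patches
`(F, G, W)` with truncation radius `r ∈ [ρ, 2ρ]` and `truncGain ≥ g`.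
`strainedCubes_of_denseImprovementT` (PROVED): `UniformlyDiscrete Y → DenseImprovementT Y → ∃ κ > 0, StrainedCubes κ Y` — the cell
grid of part II with the truncation error `2 M₀ · 432(δ⁻⁶+1)δ⁻³(ρ−R)⁻³ ≤ g/4` (choice of `ρ`) and the cross rows `≤ 216 M₀² H⁻³ ≤ g/4`
(choice of `H ≥ 2ρ + R + 1`), via the finite-gain form `superpose_estimate_fin` (part II) of the abstract estimate.
Cut: `localRelaxationTest_of_transfer : ImprovementTransfer T₀ D → LocalRelaxationTest T₀ D` with
`ImprovementTransfer T₀ D := ∀ Y, CleanClass T₀ D Y → ¬ LocallyOptimal Y → DenseImprovementT Y` (part IV).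
-/

noncomputable section

open Metric Set
open scoped BigOperators
open Literature.MathematicalPhysics.StatisticalMechanics
open Summit.AtomisticToContinuum.Crystallization.Theorems.OverbindingBudgetEdgeRelaxationStatements
open Summit.AtomisticToContinuum.Crystallization.Theorems.OverbindingBudgetElasticSplitStatements (surgeryGain LocallyOptimal LocalRelaxationTest)
open Summit.AtomisticToContinuum.Crystallization.Theorems.OverbindingBudgetCubeTails
open Summit.AtomisticToContinuum.Crystallization.Theorems.OverbindingBudgetElasticSplitDilation (enum enum_injective interactionEnergy_enum)
open Summit.AtomisticToContinuum.Crystallization.Theorems.OverbindingBudgetLocalRelaxationCut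
open Summit.AtomisticToContinuum.Crystallization.Theorems.OverbindingBudgetLocalRelaxation

namespace Summit.AtomisticToContinuum.Crystallization.Theorems.OverbindingBudgetLocalRelaxationTrunc

/-! ## §1  Truncated gains and the transfer-friendly cut -/

/-- **truncated gain** of the surgery `(F, G)` seen through the window atoms `W`:
`U(F) + I(F, W ∖ F) − U(G) − I(G, W ∖ F)` (finite sums only). -/
def truncGain (F G W : Finset (EuclideanSpace ℝ (Fin 3))) : ℝ :=
  selfEnergy F + pairSum F (W \ F) - selfEnergy G - pairSum G (W \ F)

/-- **`DenseImprovementT Y`**: one gain `g > 0`, one patch radius `R`, a threshold `ρ₀`, and for every truncation scale `ρ ≥ ρ₀` a density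
radius `Gd` such that within `Gd` of every point sits a patch `(F, G, W)`: `F ⊆ Y ∩ B̄(p,R)`, `G ⊆ B̄(p,R)` off `Y ∖ F`, `#G = #F`,
window `W = Y ∩ B̄(p, r)` with `ρ ≤ r ≤ 2ρ`, and `truncGain F G W ≥ g`. -/
def DenseImprovementT (Y : Set (EuclideanSpace ℝ (Fin 3))) : Prop :=
  ∃ g : ℝ, 0 < g ∧ ∃ R : ℝ, 0 < R ∧ ∃ ρ₀ : ℝ, 0 < ρ₀ ∧ ∀ ρ : ℝ, ρ₀ ≤ ρ → ∃ Gd : ℝ, 0 ≤ Gd ∧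
    ∀ z : EuclideanSpace ℝ (Fin 3), ∃ p : EuclideanSpace ℝ (Fin 3), dist p z ≤ Gd ∧ ∃ r : ℝ, ρ ≤ r ∧ r ≤ 2 * ρ ∧
      ∃ F G W : Finset (EuclideanSpace ℝ (Fin 3)), (↑F : Set (EuclideanSpace ℝ (Fin 3))) ⊆ Y ∧ (∀ y ∈ F, dist y p ≤ R) ∧
        (∀ x ∈ G, dist x p ≤ R) ∧ G.card = F.card ∧ Disjoint (↑G : Set (EuclideanSpace ℝ (Fin 3))) (Y \ ↑F) ∧
        (↑W : Set (EuclideanSpace ℝ (Fin 3))) = Y ∩ Metric.closedBall p r ∧ g ≤ truncGain F G W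

/-- **Piece A′ `ImprovementTransfer T₀ D`** (part IV): in the clean class ONE improving surgery yields `DenseImprovementT`. -/
def ImprovementTransfer (T₀ D : ℝ) : Prop :=
  ∀ Y : Set (EuclideanSpace ℝ (Fin 3)), CleanClass T₀ D Y → ¬ LocallyOptimal Y → DenseImprovementT Y

/-! ## §2  The superposition theorem for truncated gains -/

set_option maxHeartbeats 800000 in
/-- **dense truncated improvements strain the cubes.**  `δ`-separation, gain `g`, radius `R`, threshold `ρ₀`; packing bound
`M₀ = (2(2R+1)/δ+1)³`; truncation scale `ρ = max(ρ₀, R + 1 + 8 M₀ γ_c / g)` (`γ_c = 432(δ⁻⁶+1)δ⁻³`, so the truncation rows cost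
`≤ 2 M₀ γ_c (ρ−R)⁻³ ≤ g/4` per cell); density `Gd = Gd(ρ)`; buffer `H = max(2ρ + R + 1, 864 M₀²/g)` (cross rows `≤ 216 M₀² H⁻³ ≤ g/4`);
cells of side `D = 2(Gd + R + H)`, `κ = g/(2D³)`; then `superpose_estimate_fin` on the `n³` cells of `[0, nD)³`. [this file] -/
theorem strainedCubes_of_denseImprovementT {Y : Set (EuclideanSpace ℝ (Fin 3))} (hUD : UniformlyDiscrete Y) (hDI : DenseImprovementT Y) :
    ∃ κ : ℝ, 0 < κ ∧ StrainedCubes κ Y := by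
  obtain ⟨δ₀, hδ₀, hsep₀⟩ := id hUD
  set δ : ℝ := min δ₀ 1 with hδdef
  have hδ : 0 < δ := lt_min hδ₀ one_pos
  have hδ1 : δ ≤ 1 := min_le_right _ _
  have hsep : ∀ x ∈ Y, ∀ y ∈ Y, x ≠ y → δ ≤ dist x y := fun x hx y hy hxy => (min_le_left _ _).trans (hsep₀ x hx y hy hxy)
  obtain ⟨g, hg, R, hR, ρ₀, hρ₀, hscale⟩ := hDI
  -- packing bound per patch
  set M₀ : ℝ := (2 * (2 * R + 1) / δ + 1) ^ 3 with hM₀def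
  have hM₀0 : 0 ≤ M₀ := by positivity
  have hM₀bd : ∀ (p : EuclideanSpace ℝ (Fin 3)) (A : Finset (EuclideanSpace ℝ (Fin 3))), (↑A : Set (EuclideanSpace ℝ (Fin 3))) ⊆ Y →
      (∀ y ∈ A, dist y p ≤ R) → (A.card : ℝ) ≤ M₀ := by
    intro p A hAY hAR
    have h := card_le_of_separated_of_box A (fun i => p i - R - 1 / 2) (fun _ => 2 * R + 1) hδ (fun _ => by linarith)
      (fun y hy i => by
        have := (PiLp.dist_apply_le y p i).trans (hAR y hy)
        rw [Real.dist_eq, abs_le] at this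
        constructor <;> linarith [this.1, this.2])
      (fun y hy w hw hyw => hsep y (hAY (Finset.mem_coe.2 hy)) w (hAY (Finset.mem_coe.2 hw)) hyw)
    rw [Finset.prod_const, Finset.card_univ, Fintype.card_fin] at h
    exact h
  -- constants: truncation scale ρ, then density Gd(ρ), then buffer H, cell side D
  set γc : ℝ := 432 * (δ⁻¹ ^ 6 + 1) * δ⁻¹ ^ 3 with hγcdef
  have hγc : 0 ≤ γc := by positivity
  set ρ : ℝ := max ρ₀ (R + 1 + 8 * M₀ * γc / g) with hρdef
  have hρ₀ρ : ρ₀ ≤ ρ := le_max_left _ _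
  have hρR : R + 1 + 8 * M₀ * γc / g ≤ ρ := le_max_right _ _
  have hρ : 0 < ρ := hρ₀.trans_le hρ₀ρ
  have hMγg : 0 ≤ 8 * M₀ * γc / g := by positivity
  have hRρ : R + 1 ≤ ρ := by linarith
  have hT0 : 0 ≤ (ρ - R)⁻¹ := inv_nonneg.2 (by linarith)
  obtain ⟨Gd, hGd, hdense⟩ := hscale ρ hρ₀ρ
  choose p hpG r hρr hr2 hpatch using hdense
  choose F' G' W' hF'Y hF'R hG'R hcard hdisj hW' hgain using hpatch
  set H : ℝ := max (2 * ρ + R + 1) (864 * M₀ ^ 2 / g) with hHdef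
  have hH1 : 2 * ρ + R + 1 ≤ H := le_max_left _ _
  have hKH : 864 * M₀ ^ 2 / g ≤ H := le_max_right _ _
  have hRH : R ≤ H := by linarith
  have h1H : 1 ≤ H := by linarith
  have hH : 0 < H := by linarith
  set D : ℝ := 2 * (Gd + R + H) with hDdef
  have hD : 0 < D := by positivity
  refine ⟨g / (2 * D ^ 3), by positivity, ?_⟩
  intro ℓ₀
  set n : ℕ := ⌈ℓ₀ / D⌉₊ + 1 with hndef
  set ℓ : ℝ := n * D with hℓdef
  have hnR : (⌈ℓ₀ / D⌉₊ : ℝ) + 1 = n := by simp [hndef]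
  have hℓ₀ : ℓ₀ ≤ ℓ := by
    have h1 : ℓ₀ / D ≤ ⌈ℓ₀ / D⌉₊ := Nat.le_ceil _
    have h2 : ℓ₀ / D ≤ n := by linarith
    rw [div_le_iff₀ hD] at h2
    exact h2
  have hℓ0 : 0 ≤ ℓ := by positivity
  set c₀ : EuclideanSpace ℝ (Fin 3) := WithLp.toLp 2 (fun _ : Fin 3 => (0 : ℝ)) with hc₀def
  have hc₀ : ∀ i, c₀ i = 0 := fun i => by simp [hc₀def]
  refine ⟨ℓ, hℓ₀, c₀, ?_⟩
  set Cset : Set (EuclideanSpace ℝ (Fin 3)) := {z | ∀ i : Fin 3, c₀ i ≤ z i ∧ z i < c₀ i + ℓ} with hCsetdef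
  have hfin : (Y ∩ Cset).Finite := finite_inter_cube' hUD c₀ hℓ0
  set F : Finset (EuclideanSpace ℝ (Fin 3)) := hfin.toFinset with hFdef
  have hFset : (↑F : Set (EuclideanSpace ℝ (Fin 3))) = Y ∩ Cset := hfin.coe_toFinset
  have hFY : (↑F : Set (EuclideanSpace ℝ (Fin 3))) ⊆ Y := hFset ▸ Set.inter_subset_left
  refine ⟨F, hFset, ?_⟩
  -- the cells
  set zc : (Fin 3 → Fin n) → EuclideanSpace ℝ (Fin 3) :=
    fun k => WithLp.toLp 2 (fun i : Fin 3 => D * (((k i : ℕ) : ℝ) + 1 / 2)) with hzcdef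
  have hzci : ∀ k i, zc k i = D * (((k i : ℕ) : ℝ) + 1 / 2) := fun k i => by simp [hzcdef]
  -- (f1) coordinates of points within `t` of a patch centre (margin `D/2 − Gd − t`)
  have hco : ∀ (k : Fin 3 → Fin n) (a : EuclideanSpace ℝ (Fin 3)) (t : ℝ), dist a (p (zc k)) ≤ t →
      ∀ i, D * ((k i : ℕ) : ℝ) + (D / 2 - Gd - t) ≤ a i ∧ a i ≤ D * (((k i : ℕ) : ℝ) + 1) - (D / 2 - Gd - t) := by
    intro k a t ha i
    have h1 : dist a (zc k) ≤ t + Gd := (dist_triangle a (p (zc k)) (zc k)).trans (add_le_add ha (hpG (zc k)))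
    have h2 := (PiLp.dist_apply_le a (zc k) i).trans h1
    rw [hzci, Real.dist_eq, abs_le] at h2
    constructor <;> linarith [h2.1, h2.2]
  have hkn : ∀ (k : Fin 3 → Fin n) (i : Fin 3), ((k i : ℕ) : ℝ) + 1 ≤ n := fun k i => by exact_mod_cast (k i).isLt
  -- (f2) points within `2ρ` (hence within `R`) of a patch centre lie in the cube
  have hmemC : ∀ (k : Fin 3 → Fin n) (a : EuclideanSpace ℝ (Fin 3)), dist a (p (zc k)) ≤ 2 * ρ → a ∈ Cset := by
    intro k a ha i
    rw [hc₀]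
    have h := hco k a (2 * ρ) ha i
    have h0 : 0 ≤ D * ((k i : ℕ) : ℝ) := by positivity
    have h3 : D * (((k i : ℕ) : ℝ) + 1) ≤ D * n := mul_le_mul_of_nonneg_left (hkn k i) hD.le
    constructor <;> linarith [h.1, h.2]
  have hmemCR : ∀ (k : Fin 3 → Fin n) (a : EuclideanSpace ℝ (Fin 3)), dist a (p (zc k)) ≤ R → a ∈ Cset :=
    fun k a ha => hmemC k a (by linarith [hRρ, hρ])
  -- (f3) distinct cells: patch centres `≥ 2(R+H)` apart
  have hsepc : ∀ k l : Fin 3 → Fin n, k ≠ l → 2 * (R + H) ≤ dist (p (zc k)) (p (zc l)) := by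
    intro k l hkl
    obtain ⟨i, hi⟩ := Function.ne_iff.1 hkl
    have hi' : (k i : ℕ) ≠ (l i : ℕ) := Fin.val_ne_of_ne hi
    have hzi : D ≤ |zc k i - zc l i| := by
      rw [hzci, hzci]
      rcases Nat.lt_or_gt_of_ne hi' with hlt | hlt
      · have : ((k i : ℕ) : ℝ) + 1 ≤ ((l i : ℕ) : ℝ) := by exact_mod_cast hlt
        rw [abs_sub_comm, abs_of_nonneg (by nlinarith)]
        nlinarith
      · have : ((l i : ℕ) : ℝ) + 1 ≤ ((k i : ℕ) : ℝ) := by exact_mod_cast hlt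
        rw [abs_of_nonneg (by nlinarith)]
        nlinarith
    have hz : D ≤ dist (zc k) (zc l) := le_trans (by rw [← Real.dist_eq] at hzi; exact hzi) (PiLp.dist_apply_le (zc k) (zc l) i)
    have t := dist_triangle4 (zc k) (p (zc k)) (p (zc l)) (zc l)
    rw [dist_comm (zc k) (p (zc k))] at t
    linarith [hpG (zc k), hpG (zc l)]
  -- (f4) windows inside the cube and the truncation rows
  have hWF : ∀ k : Fin 3 → Fin n, W' (zc k) ⊆ F := by
    intro k w hw
    have hw' : w ∈ (↑(W' (zc k)) : Set (EuclideanSpace ℝ (Fin 3))) := Finset.mem_coe.2 hw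
    rw [hW' (zc k)] at hw'
    rw [← Finset.mem_coe, hFset]
    exact ⟨hw'.1, hmemC k w ((Metric.mem_closedBall.1 hw'.2).trans (hr2 (zc k)))⟩
  have hF'W : ∀ k : Fin 3 → Fin n, F' (zc k) ⊆ W' (zc k) := by
    intro k y hy
    rw [← Finset.mem_coe, hW' (zc k)]
    exact ⟨hF'Y (zc k) (Finset.mem_coe.2 hy), Metric.mem_closedBall.2 ((hF'R (zc k) y hy).trans (by linarith [hρr (zc k), hRρ]))⟩
  have htrunc : ∀ (k : Fin 3 → Fin n) (a : EuclideanSpace ℝ (Fin 3)), dist a (p (zc k)) ≤ R →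
      ∑ b ∈ F \ W' (zc k), |lennardJones (dist a b)| ≤ γc * (ρ - R)⁻¹ ^ 3 := by
    intro k a ha
    refine sum_abs_lennardJones_le_dyadic _ a hδ (by linarith [hRρ, hδ1] : δ ≤ ρ - R) ?_ ?_
    · intro b hb
      rw [Finset.mem_sdiff] at hb
      have hbY : b ∈ Y := hFY (Finset.mem_coe.2 hb.1)
      have hbW : b ∉ Y ∩ Metric.closedBall (p (zc k)) (r (zc k)) := by
        rw [← hW' (zc k)]; exact fun h => hb.2 (Finset.mem_coe.1 h)
      have hfar : r (zc k) < dist b (p (zc k)) := by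
        by_contra hle
        exact hbW ⟨hbY, Metric.mem_closedBall.2 (not_lt.1 hle)⟩
      have t := dist_triangle b a (p (zc k))
      rw [dist_comm b a] at t
      linarith [hρr (zc k)]
    · intro b hb b' hb' hne
      exact hsep b (hFY (Finset.mem_coe.2 (Finset.mem_sdiff.1 hb).1)) b' (hFY (Finset.mem_coe.2 (Finset.mem_sdiff.1 hb').1)) hne
  -- (f5) finite gain per cell ≥ g − 2 M₀ γc (ρ−R)⁻³
  have hfin : ∀ k : Fin 3 → Fin n, g - 2 * M₀ * (γc * (ρ - R)⁻¹ ^ 3) ≤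
      selfEnergy (F' (zc k)) + pairSum (F' (zc k)) (F \ F' (zc k)) - selfEnergy (G' (zc k)) - pairSum (G' (zc k)) (F \ F' (zc k)) := by
    intro k
    have hsplit : F \ F' (zc k) = (W' (zc k) \ F' (zc k)) ∪ (F \ W' (zc k)) := by
      ext x
      simp only [Finset.mem_sdiff, Finset.mem_union]
      constructor
      · intro ⟨hxF, hxF'⟩
        by_cases hxW : x ∈ W' (zc k)
        · exact Or.inl ⟨hxW, hxF'⟩
        · exact Or.inr ⟨hxF, hxW⟩
      · rintro (⟨hxW, hxF'⟩ | ⟨hxF, hxW⟩)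
        · exact ⟨hWF k hxW, hxF'⟩
        · exact ⟨hxF, fun h => hxW (hF'W k h)⟩
    have hdj : Disjoint (W' (zc k) \ F' (zc k)) (F \ W' (zc k)) := by
      rw [Finset.disjoint_left]
      intro x hx hx'
      exact (Finset.mem_sdiff.1 hx').2 (Finset.mem_sdiff.1 hx).1
    rw [hsplit, pairSum_union_right _ hdj, pairSum_union_right _ hdj]
    have hg := hgain (zc k)
    simp only [truncGain] at hg
    have tF : |pairSum (F' (zc k)) (F \ W' (zc k))| ≤ M₀ * (γc * (ρ - R)⁻¹ ^ 3) :=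
      (abs_pairSum_le fun a ha => htrunc k a (hF'R (zc k) a ha)).trans
        (mul_le_mul_of_nonneg_right (hM₀bd _ _ (hF'Y (zc k)) (hF'R (zc k))) (mul_nonneg hγc (pow_nonneg hT0 3)))
    have tG : |pairSum (G' (zc k)) (F \ W' (zc k))| ≤ M₀ * (γc * (ρ - R)⁻¹ ^ 3) :=
      (abs_pairSum_le fun a ha => htrunc k a (hG'R (zc k) a ha)).trans
        (mul_le_mul_of_nonneg_right (by rw [hcard (zc k)]; exact hM₀bd _ _ (hF'Y (zc k)) (hF'R (zc k))) (mul_nonneg hγc (pow_nonneg hT0 3)))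
    rw [abs_le] at tF tG
    linarith [tF.1, tF.2, tG.1, tG.2]
  -- (f6) the dyadic sum of the cross rows
  have hcross : ∀ k : Fin 3 → Fin n,
      ∑ l ∈ Finset.univ.erase k, 16 * M₀ * (dist (p (zc k)) (p (zc l)))⁻¹ ^ 6 ≤
        16 * M₀ * (432 * (2 * (R + H))⁻¹ ^ 3 * (2 * (R + H))⁻¹ ^ 3) := by
    intro k
    rw [← Finset.mul_sum]
    refine mul_le_mul_of_nonneg_left ?_ (by positivity)
    have hinj : ∀ l ∈ Finset.univ.erase k, ∀ l' ∈ Finset.univ.erase k, p (zc l) = p (zc l') → l = l' := by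
      intro l _ l' _ hll
      by_contra hne
      have := hsepc l l' hne
      rw [hll, dist_self] at this
      linarith
    have hsi : ∑ l ∈ Finset.univ.erase k, (dist (p (zc k)) (p (zc l)))⁻¹ ^ 6 =
        ∑ q ∈ (Finset.univ.erase k).image (fun l => p (zc l)), (dist (p (zc k)) q)⁻¹ ^ 6 := by
      rw [Finset.sum_image hinj]
    rw [hsi]
    refine sum_inv_pow_six_le_dyadic _ (p (zc k)) (by positivity : (0 : ℝ) < 2 * (R + H)) le_rfl ?_ ?_
    · intro q hq
      obtain ⟨l, hl, rfl⟩ := Finset.mem_image.1 hq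
      exact hsepc k l (Finset.ne_of_mem_erase hl).symm
    · intro q hq q' hq' hne
      obtain ⟨l, hl, rfl⟩ := Finset.mem_image.1 hq
      obtain ⟨l', hl', rfl⟩ := Finset.mem_image.1 hq'
      exact hsepc l l' fun h => hne (by rw [h])
  -- (f7) the error budget: truncation ≤ g/4, cross rows ≤ g/4
  have herr : 2 * M₀ * (γc * (ρ - R)⁻¹ ^ 3) + 2 * M₀ * (16 * M₀ * (432 * (2 * (R + H))⁻¹ ^ 3 * (2 * (R + H))⁻¹ ^ 3)) ≤ g / 2 := by
    -- truncation part
    have hv0 : 0 ≤ (ρ - R)⁻¹ := hT0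
    have hv1 : (ρ - R)⁻¹ ≤ 1 := inv_le_one_of_one_le₀ (by linarith [hRρ])
    have hv3 : (ρ - R)⁻¹ ^ 3 ≤ (ρ - R)⁻¹ := by
      have := pow_le_pow_of_le_one hv0 hv1 (by norm_num : 1 ≤ 3)
      rwa [pow_one] at this
    have hT : 8 * M₀ * γc * (ρ - R)⁻¹ ≤ g := by
      rw [← div_eq_mul_inv, div_le_iff₀ (by linarith [hRρ] : (0 : ℝ) < ρ - R)]
      have h8 : 8 * M₀ * γc / g ≤ ρ - R - 1 := by linarith
      rw [div_le_iff₀ hg] at h8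
      nlinarith
    have hT3 : 8 * M₀ * γc * (ρ - R)⁻¹ ^ 3 ≤ 8 * M₀ * γc * (ρ - R)⁻¹ := mul_le_mul_of_nonneg_left hv3 (by positivity)
    -- cross part
    have hu0 : 0 ≤ H⁻¹ := inv_nonneg.2 hH.le
    have hu1 : H⁻¹ ≤ 1 := inv_le_one_of_one_le₀ h1H
    have hD'inv : (2 * (R + H))⁻¹ ≤ H⁻¹ / 2 := by
      have h := inv_anti₀ (by positivity : (0 : ℝ) < 2 * H) (by linarith : 2 * H ≤ 2 * (R + H))
      have e : (2 * H)⁻¹ = H⁻¹ / 2 := by rw [mul_inv]; ring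
      linarith [e]
    have hD'0 : 0 ≤ (2 * (R + H))⁻¹ := by positivity
    have hP : (2 * (R + H))⁻¹ ^ 3 * (2 * (R + H))⁻¹ ^ 3 ≤ H⁻¹ ^ 3 / 64 := by
      have h6 : (2 * (R + H))⁻¹ ^ 6 ≤ (H⁻¹ / 2) ^ 6 := pow_le_pow_left₀ hD'0 hD'inv 6
      have h63 : H⁻¹ ^ 6 ≤ H⁻¹ ^ 3 := pow_le_pow_of_le_one hu0 hu1 (by norm_num)
      have e : (2 * (R + H))⁻¹ ^ 3 * (2 * (R + H))⁻¹ ^ 3 = (2 * (R + H))⁻¹ ^ 6 := by ring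
      have e2 : (H⁻¹ / 2) ^ 6 = H⁻¹ ^ 6 / 64 := by ring
      rw [e]; linarith
    have hu3 : H⁻¹ ^ 3 ≤ H⁻¹ := by
      have := pow_le_pow_of_le_one hu0 hu1 (by norm_num : 1 ≤ 3)
      rwa [pow_one] at this
    have hKu : 864 * M₀ ^ 2 * H⁻¹ ≤ g := by
      rw [← div_eq_mul_inv, div_le_iff₀ hH]
      rw [div_le_iff₀ hg] at hKH
      linarith
    have h2 : M₀ * M₀ * ((2 * (R + H))⁻¹ ^ 3 * (2 * (R + H))⁻¹ ^ 3) ≤ M₀ * M₀ * (H⁻¹ ^ 3 / 64) :=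
      mul_le_mul_of_nonneg_left hP (by positivity)
    have h3 : M₀ ^ 2 * H⁻¹ ^ 3 ≤ M₀ ^ 2 * H⁻¹ := mul_le_mul_of_nonneg_left hu3 (by positivity)
    linarith [h2, h3, hKu, hT, hT3]
  -- (f8) the abstract estimate on the grid
  have hest := superpose_estimate_fin (Y := Y) (Finset.univ : Finset (Fin 3 → Fin n)) F hFY (fun k => F' (zc k)) (fun k => G' (zc k))
    (fun k _ => (hF'W k).trans (hWF k))
    (fun k _ l _ hkl => by
      rw [Function.onFun, Finset.disjoint_left]
      intro y hyk hyl
      have t := dist_triangle (p (zc k)) y (p (zc l))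
      rw [dist_comm (p (zc k)) y] at t
      linarith [hF'R (zc k) y hyk, hF'R (zc l) y hyl, hsepc k l hkl])
    (fun k _ l _ hkl => by
      rw [Function.onFun, Finset.disjoint_left]
      intro y hyk hyl
      have t := dist_triangle (p (zc k)) y (p (zc l))
      rw [dist_comm (p (zc k)) y] at t
      linarith [hG'R (zc k) y hyk, hG'R (zc l) y hyl, hsepc k l hkl])
    (fun k _ => hdisj (zc k)) (fun k _ => hcard (zc k)) (E := 2 * M₀ * (γc * (ρ - R)⁻¹ ^ 3)) (M₀ := M₀)
    (β := fun k l => 16 * M₀ * (dist (p (zc k)) (p (zc l)))⁻¹ ^ 6) (fun k l => by positivity)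
    (fun k _ => hM₀bd _ _ (hF'Y (zc k)) (hF'R (zc k))) (fun k _ => hfin k)
    (fun k _ l _ hkl a ha => row_le hR.le hRH h1H (hF'R (zc k) a ha) (hF'R (zc l)) (hsepc k l hkl) (hM₀bd _ _ (hF'Y (zc l)) (hF'R (zc l))))
    (fun k _ l _ hkl a ha => row_le hR.le hRH h1H (hG'R (zc k) a ha) (hF'R (zc l)) (hsepc k l hkl) (hM₀bd _ _ (hF'Y (zc l)) (hF'R (zc l))))
    (fun k _ l _ hkl a ha => row_le hR.le hRH h1H (hG'R (zc k) a ha) (hG'R (zc l)) (hsepc k l hkl)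
      (by rw [hcard (zc l)]; exact hM₀bd _ _ (hF'Y (zc l)) (hF'R (zc l))))
    (fun k _ => by
      have h1 : 2 * M₀ * ∑ l ∈ Finset.univ.erase k, 16 * M₀ * (dist (p (zc k)) (p (zc l)))⁻¹ ^ 6 ≤
          2 * M₀ * (16 * M₀ * (432 * (2 * (R + H))⁻¹ ^ 3 * (2 * (R + H))⁻¹ ^ 3)) := mul_le_mul_of_nonneg_left (hcross k) (by positivity)
      linarith [herr])
  -- (f9) `#cells · g/2 = κ ℓ³`
  have hcardι : ((Finset.univ : Finset (Fin 3 → Fin n)).card : ℝ) = (n : ℝ) ^ 3 := by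
    rw [Finset.card_univ]; push_cast [Fintype.card_fun, Fintype.card_fin]; try ring
  have hκ : g / (2 * D ^ 3) * ℓ ^ 3 = (n : ℝ) ^ 3 * (g / 2) := by
    rw [hℓdef]; field_simp
  rw [hκ, ← hcardι]
  exact hest

/-- the transfer-friendly cut: LRT ⟸ `ImprovementTransfer`. -/
theorem localRelaxationTest_of_transfer {T₀ D : ℝ} (hA : ImprovementTransfer T₀ D) : LocalRelaxationTest T₀ D :=
  fun Y hW hnot => strainedCubes_of_denseImprovementT hW.1 (hA Y hW hnot)

end Summit.AtomisticToContinuum.Crystallization.Theorems.OverbindingBudgetLocalRelaxationTrunc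

end
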